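import Literature.NumberTheory.EllipticCurves.TateCurve.TateFormalIdentity
import Literature.NumberTheory.EllipticCurves.TateCurve.UniformizationPartner
import HarnessLib

/-!
# Silverman ATAEC §V.4: the level partner of a point off `E_{q,0}`, with the on-curve input
# discharged by V.3.1 (c) (`tate_onCurve`)

J. H. Silverman, *Advanced Topics in the Arithmetic of Elliptic Curves*, GTM 151, §V.4, Lemma 4.1.4
and the surjectivity step of Thm. V.3.1 (c), PDF pp. 400–405
[cite: SilvermanATAEC1994, Lemma V.4.1.4 (PDF p. 404)].  `UniformizationPartner.exists_partner_dichotomy`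
takes as a hypothesis that `φ(u) = (X(u,q), Y(u,q))` lies on `E_q` for `u` in the fundamental
annulus `‖q‖ < ‖u‖ < 1`; abc-iut-L2-t5's `TateFormalIdentity.tate_onCurve` (V.3.1 (c), first part)
proves this for every `u ∈ Kˣ ∖ q^ℤ`.  This file discharges the hypothesis
(`tate_onCurve_of_norm_lt_of_lt`) and records the hypothesis-free partner theorem
`exists_partner_dichotomy_of_onCurve`: for every affine point `(x, y)` of the Tate curve with
`‖x‖ < 1` there is `u`, `‖q‖ < ‖u‖ < 1`, with `(x, y) = (X(u,q), Y(u,q))` or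
`‖x(P − φ(u))‖ ≥ 1` (chord formula, see `UniformizationChord.lean`).  Complete ultrametric field,
`12` invertible, `0 < ‖q‖ < 1`.  Classical.  Seat abc-iut-L2-t6.
-/

noncomputable section

namespace Literature.NumberTheory.EllipticCurves.TateCurve

open SteinWuthrich2013

variable {K : Type*} [NontriviallyNormedField K] [CompleteSpace K] {q : K}

/-- V.3.1 (c) on the open fundamental annulus: for `‖q‖ < ‖u‖ < 1` the point `(X(u,q), Y(u,q))`
lies on `E_q` (`tate_onCurve` + `ne_zpow_of_norm_lt_of_lt`). [cite: SilvermanATAEC1994, Thm. V.3.1 (c) (PDF pp. 395–397)] -/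
theorem tate_onCurve_of_norm_lt_of_lt (h12 : (12 : K) ≠ 0) (hq0 : q ≠ 0) (hq : ‖q‖ < 1) {u : K}
    (hqu : ‖q‖ < ‖u‖) (hu1 : ‖u‖ < 1) :
    tateY q u ^ 2 + tateX q u * tateY q u = tateX q u ^ 3 + tateA4 q * tateX q u + tateA6 q := by
  have hu0 : u ≠ 0 := norm_pos_iff.mp (lt_of_le_of_lt (norm_nonneg q) hqu)
  have h := tate_onCurve hq0 hq h12 (Units.mk0 u hu0)
    (fun n => by rw [Units.val_mk0]; exact ne_zpow_of_norm_lt_of_lt hqu hu1 n)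
  simpa only [Units.val_mk0] using h

variable [IsUltrametricDist K]

/-- **Level partner, hypothesis-free form.**  For every affine point `(x, y)` of
`E_q : y² + xy = x³ + a₄(q)x + a₆(q)` with `‖x‖ < 1` (`P ∉ E_{q,0}`) there is `u` with
`‖q‖ < ‖u‖ < 1` such that either `(x, y) = (X(u,q), Y(u,q))` or the `x`-coordinate
`λ² + λ − x − X(u)`, `λ = (y + Y(u) + X(u))/(x − X(u))`, of `P − φ(u)` has norm `≥ 1`.
[cite: SilvermanATAEC1994, Lemma V.4.1.4 (PDF p. 404)] -/
theorem exists_partner_dichotomy_of_onCurve (h12 : (12 : K) ≠ 0) (hq0 : q ≠ 0) (hq : ‖q‖ < 1)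
    {x y : K} (heq : y ^ 2 + x * y = x ^ 3 + tateA4 q * x + tateA6 q) (hx : ‖x‖ < 1) :
    ∃ u : K, ‖q‖ < ‖u‖ ∧ ‖u‖ < 1 ∧ ((x = tateX q u ∧ y = tateY q u) ∨
      1 ≤ ‖((y + tateY q u + tateX q u) / (x - tateX q u)) ^ 2
            + (y + tateY q u + tateX q u) / (x - tateX q u) - x - tateX q u‖) :=
  exists_partner_dichotomy h12 hq0 hq
    (fun _ hqu hu1 => tate_onCurve_of_norm_lt_of_lt h12 hq0 hq hqu hu1) heq hx

end Literature.NumberTheory.EllipticCurves.TateCurve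

end
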